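import Mathlib
import Literature.Analysis.FluidPDE.CKNMorreyQuadraticMean
import Literature.Analysis.FunctionSpaces.WeakDerivInner
import Literature.Analysis.FunctionSpaces.SobolevDomainProofs
import Literature.Analysis.FunctionSpaces.SobolevTraceDensityProofs
import Literature.Analysis.FluidPDE.SwirlTransportProofs
import Literature.Analysis.FluidPDE.VorticityStretching

/-!
# Crux `EulerZoomLiouville.PowerGaugeEulerLiouville` (stmt-NavierStokesRegularity-19832), weak stratum, line `weak_axisym` (ns-idea-11 g9):
# X1a, PART (A) — THE VORTICITY OF A WEAK AXISYMMETRIC SWIRL-FREE FIELD IS AZIMUTHAL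

Width seat ns-ezl-w2 g6 under the LEAD ns-typeII-p2 g15.  First-order weak calculus on the DiPerna–Lions data, no class, no Euler:
let `V : ℝ³ → ℝ³` have a whole-space weak gradient `G` (`HasWeakFDerivOn ⊤ volume V G`), and suppose, with `k×y = (−y₁, y₀, 0)`
(the line's `kcross`, the tree's `rotGen`),
(1) infinitesimal rotation-equivariance `G(y)(k×y) = k×V(y)` a.e. and (2) no swirl `⟪V(y), k×y⟫ = 0` a.e.
Then (`curlCLM_ae_eq_eta_smul`) the a.e. vorticity `Ω = curlCLM ∘ G` is AZIMUTHAL: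
`Ω(y) = η(y)·(k×y)` a.e. with `η = ⟪Ω, k×y⟫/(y₀² + y₁²)` (the line's `etaOf G`), i.e. the conclusion `IsAzimuthalVorticity G` of
`Sig.stub_axisymReduction` with the line's reducible definitions unfolded.

Proof.  The swirl `s(y) = ⟪V(y), k×y⟫ = y₀V₁ − y₁V₀` has the weak gradient `w ↦ w₀V₁ + y₀∂_wV₁ − w₁V₀ − y₁∂_wV₀` (weak product rule with the
smooth coordinates, `HasWeakFDerivOn.inner_const/smul_contDiff/sub`); `s = 0` a.e. forces that gradient to vanish a.e.
(`weakFDeriv_apply_ae_eq_zero`: the defining identity and `ae_eq_zero_of_integral_contDiff_smul_eq_zero`).  Its `e₀`- and `e₂`-components and the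
`0`- and `2`-components of (1) give, off the null hyperplane `{y₀ = 0}`, `Ω₂ = 0` and `y₀Ω₀ + y₁Ω₁ = 0`, which is `Ω = η·(k×y)` componentwise.

WHAT THIS IS NOT: not NS, not E, not X1a itself (the damped Casimir law `SolvesThetaTransport` is the sequel) — 19832 is OPEN. [folklore]
-/

noncomputable section

set_option linter.dupNamespace false

open MeasureTheory Set Filter Topology Function TopologicalSpace
open scoped ENNReal NNReal RealInnerProductSpace ContDiff

namespace Summit.NavierStokesRegularity.NavierStokesRegularity.Theorems.PowerGaugeEulerLiouville.WeakAxisym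

open Literature.Analysis.FunctionSpaces Literature.Analysis.FluidPDE

/-- A weak gradient of an a.e.-vanishing scalar vanishes a.e. (each directional component): the defining identity tested against `φ`
gives `∫ φ·(g·v) = 0` for every test `φ`. [folklore] -/
theorem weakFDeriv_apply_ae_eq_zero {f : EuclideanSpace ℝ (Fin 3) → ℝ}
    {g : EuclideanSpace ℝ (Fin 3) → EuclideanSpace ℝ (Fin 3) →L[ℝ] ℝ}
    (h : HasWeakFDerivOn (⊤ : Opens (EuclideanSpace ℝ (Fin 3))) volume f g) (hf : f =ᵐ[volume] 0)
    (v : EuclideanSpace ℝ (Fin 3)) :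
    ∀ᵐ y ∂(volume : Measure (EuclideanSpace ℝ (Fin 3))), g y v = 0 := by
  have hli : LocallyIntegrable (fun y => g y v) volume := by
    have h1 := SobolevApprox.locallyIntegrableOn_deriv_apply h v
    rwa [Opens.coe_top, locallyIntegrableOn_univ] at h1
  refine ae_eq_zero_of_integral_contDiff_smul_eq_zero hli fun φ hφ hφc => ?_
  have key := h.integral_fderiv_smul_eq φ v ⟨hφ, hφc, by simp⟩
  rw [Opens.coe_top, Measure.restrict_univ] at key
  have h0 : ∫ x, (fderiv ℝ φ x v) • f x ∂(volume : Measure (EuclideanSpace ℝ (Fin 3))) = 0 := by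
    refine integral_eq_zero_of_ae ?_
    filter_upwards [hf] with x hx
    rw [hx, Pi.zero_apply, smul_zero]
  rw [h0] at key
  exact neg_eq_zero.1 key.symm

/-- The hyperplane `{y₀ = 0}` (hence the `y₃`-axis) is Lebesgue-null in `ℝ³`. [folklore] -/
theorem ae_coord_zero_ne_zero : ∀ᵐ y ∂(volume : Measure (EuclideanSpace ℝ (Fin 3))), y 0 ≠ 0 := by
  have hN : (volume : Measure (EuclideanSpace ℝ (Fin 3))) {y | y 0 = 0} = 0 := by
    have hs : ({y | y 0 = 0} : Set (EuclideanSpace ℝ (Fin 3))) =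
        (LinearMap.ker (EuclideanSpace.projₗ (𝕜 := ℝ) (0 : Fin 3)) : Submodule ℝ (EuclideanSpace ℝ (Fin 3))) := by
      ext y; simp
    rw [hs]
    refine Measure.addHaar_submodule volume _ fun htop => ?_
    have hmem : EuclideanSpace.single (0 : Fin 3) (1 : ℝ) ∈ LinearMap.ker (EuclideanSpace.projₗ (𝕜 := ℝ) (0 : Fin 3)) := by
      rw [htop]; trivial
    simp at hmem
  rw [ae_iff]
  simpa using hN

/-- **X1a (A): the vorticity of a weak axisymmetric swirl-free field is azimuthal.**  For `V` with whole-space weak gradient `G`,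
(1) `G(y)(k×y) = k×V(y)` a.e. and (2) `⟪V(y), k×y⟫ = 0` a.e. imply `curlCLM (G y) = (⟪curlCLM (G y), k×y⟫/(y₀²+y₁²))·(k×y)` a.e.
(`k×y = (−y₁, y₀, 0)`; the texts are the line's `kcross`, `cylRadSq`, `etaOf`, `IsAzimuthalVorticity` unfolded). [folklore] -/
theorem curlCLM_ae_eq_eta_smul {V : EuclideanSpace ℝ (Fin 3) → EuclideanSpace ℝ (Fin 3)}
    {G : EuclideanSpace ℝ (Fin 3) → EuclideanSpace ℝ (Fin 3) →L[ℝ] EuclideanSpace ℝ (Fin 3)}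
    (hVG : HasWeakFDerivOn (⊤ : Opens (EuclideanSpace ℝ (Fin 3))) volume V G)
    (h1 : ∀ᵐ y ∂(volume : Measure (EuclideanSpace ℝ (Fin 3))),
      G y (WithLp.toLp 2 ![-(y 1), y 0, 0]) = WithLp.toLp 2 ![-(V y 1), V y 0, 0])
    (h2 : ∀ᵐ y ∂(volume : Measure (EuclideanSpace ℝ (Fin 3))), inner ℝ (V y) (WithLp.toLp 2 ![-(y 1), y 0, 0]) = 0) :
    ∀ᵐ y ∂(volume : Measure (EuclideanSpace ℝ (Fin 3))),
      curlCLM (G y) =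
        (inner ℝ (curlCLM (G y)) (WithLp.toLp 2 ![-(y 1), y 0, 0]) / (y 0 ^ 2 + y 1 ^ 2)) •
          WithLp.toLp 2 ![-(y 1), y 0, 0] := by
  -- `k×y` is the tree's `rotGen y` (definitionally)
  have ek : ∀ y : EuclideanSpace ℝ (Fin 3), (WithLp.toLp 2 ![-(y 1), y 0, 0] : EuclideanSpace ℝ (Fin 3)) = rotGen y :=
    fun _ => rfl
  simp only [ek] at h1 h2 ⊢
  -- ### the swirl `y₀V₁ − y₁V₀` and its weak gradient
  have hθ : ∀ j : Fin 3, ContDiff ℝ ∞ (fun y : EuclideanSpace ℝ (Fin 3) => y j) := fun j =>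
    (EuclideanSpace.proj (𝕜 := ℝ) j).contDiff
  have hdθ : ∀ (j : Fin 3) (y w : EuclideanSpace ℝ (Fin 3)), fderiv ℝ (fun y : EuclideanSpace ℝ (Fin 3) => y j) y w = w j := by
    intro j y w
    change fderiv ℝ (⇑(EuclideanSpace.proj (𝕜 := ℝ) j)) y w = w j
    rw [ContinuousLinearMap.fderiv]
    rfl
  have hc : ∀ i : Fin 3, HasWeakFDerivOn (⊤ : Opens (EuclideanSpace ℝ (Fin 3))) volume
      (fun y => ⟪V y, EuclideanSpace.single i (1 : ℝ)⟫)
      (fun y => (innerSL ℝ (EuclideanSpace.single i (1 : ℝ))).comp (G y)) := fun i => hVG.inner_const _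
  have hA := ((hc 1).smul_contDiff (hθ 0)).sub ((hc 0).smul_contDiff (hθ 1))
  have hs0 : ((fun y : EuclideanSpace ℝ (Fin 3) => y 0 • ⟪V y, EuclideanSpace.single 1 (1 : ℝ)⟫) -
      fun y : EuclideanSpace ℝ (Fin 3) => y 1 • ⟪V y, EuclideanSpace.single 0 (1 : ℝ)⟫) =ᵐ[volume] 0 := by
    filter_upwards [h2] with y hy
    rw [real_inner_comm, inner_rotGen_left] at hy
    simp only [Pi.sub_apply, Pi.zero_apply, smul_eq_mul, EuclideanSpace.inner_single_right, conj_trivial, one_mul]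
    linarith
  -- the `e₀`- and `e₂`-components of the vanishing weak gradient of the swirl
  have hD0 := weakFDeriv_apply_ae_eq_zero hA hs0 (EuclideanSpace.single 0 (1 : ℝ))
  have hD2 := weakFDeriv_apply_ae_eq_zero hA hs0 (EuclideanSpace.single 2 (1 : ℝ))
  filter_upwards [hD0, hD2, h1, ae_coord_zero_ne_zero] with y a0 a2 b hy0
  have f02 : ¬ ((0 : Fin 3) = 2) := by decide
  have f12 : ¬ ((1 : Fin 3) = 2) := by decide
  have f10 : ¬ ((1 : Fin 3) = 0) := by decide
  simp only [Pi.sub_apply, sub_apply, add_apply,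
    ContinuousLinearMap.smulRight_apply, smul_apply, ContinuousLinearMap.coe_comp,
    Function.comp_apply, innerSL_apply_apply, EuclideanSpace.inner_single_left, EuclideanSpace.inner_single_right,
    map_one, one_mul, hdθ, PiLp.single_apply, smul_eq_mul, f02, f12, f10, if_true, if_false, zero_mul, zero_add] at a0 a2
  -- components of (1): `y₀ ∂₁Vᵢ − y₁ ∂₀Vᵢ = (k×V)ᵢ`
  rw [rotGen_eq_sub_single, map_sub, map_smul, map_smul] at b
  have b0 := congrArg (fun v : EuclideanSpace ℝ (Fin 3) => v 0) b
  have b2 := congrArg (fun v : EuclideanSpace ℝ (Fin 3) => v 2) b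
  simp only [PiLp.sub_apply, PiLp.smul_apply, smul_eq_mul, rotGen_apply_zero, rotGen_apply_two] at b0 b2
  -- the curl components
  have hρ : y 0 ^ 2 + y 1 ^ 2 ≠ 0 := by positivity
  rw [real_inner_comm, inner_rotGen_left]
  ext i
  fin_cases i
  · simp only [curlCLM_apply, PiLp.smul_apply, PiLp.toLp_apply, smul_eq_mul, rotGen_apply_zero,
      Fin.zero_eta, Matrix.cons_val_zero, Matrix.cons_val_one]
    field_simp
    linear_combination (y 0) * b2 - (y 0) * a2
  · simp only [curlCLM_apply, PiLp.smul_apply, PiLp.toLp_apply, smul_eq_mul, rotGen_apply_one,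
      Fin.mk_one, Matrix.cons_val_zero, Matrix.cons_val_one]
    field_simp
    linear_combination (y 1) * b2 - (y 1) * a2
  · simp only [curlCLM_apply, PiLp.smul_apply, PiLp.toLp_apply, smul_eq_mul, rotGen_apply_two,
      Fin.reduceFinMk, Matrix.cons_val_two, Matrix.tail_cons, Matrix.head_cons, Matrix.cons_val]
    -- `Ω₂ = ∂₀V₁ − ∂₁V₀ = 0` from `y₀ Ω₂ = 0`
    have h : y 0 * (G y (EuclideanSpace.single 0 1) 1 - G y (EuclideanSpace.single 1 1) 0) = 0 := by
      linear_combination a0 - b0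
    simpa [hy0] using h

end Summit.NavierStokesRegularity.NavierStokesRegularity.Theorems.PowerGaugeEulerLiouville.WeakAxisym

end
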